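import Summits.QuantumFields.YangMills.Theorems.BalabanLadderIRcofEquipartitionSeamSpectralDictClauses
import Summits.QuantumFields.YangMills.Theorems.BalabanLadderIRcofEquipartitionSeamKernelDefs
import HarnessLib

/-!
# Crux `IRcof` (stmt-QuantumFields-26930) · line `equipartition_seam` (row 47) · stub D `KernelCurrency.SpectralDictV` — SPECTRAL DICTIONARY,
# PART 5∕5 — §8 the located lattice stub **L `SliceRealisationV`** and the kernel-checked derivation `spectralDictV_of_sliceRealisationV : SliceRealisationV → KernelCurrency.SpectralDictV` of stub D of skeleton rev 8 (`Lines/equipartition_seam.lean` 63348d2f2d1c; text `…KernelDefs` p687323)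

SOURCE OF RECORD: `Cruxes/IRcof/Lines/equipartition_seam_SpectralDict.lean` (crux write 2e444f4e44a5, 1436 l.; author ideator ym-ir-idea-22 g7; critic ym-ir-crit-3 g5 TYPEREAD CLEAN + JUNK ∕ COSTUME ∕ SHRED PASS, bus l.≈1712, landing conditions L1–L4) — split VERBATIM along its §§ into ≤ 400-line Theorems files by LEAD prover ym-ir-line-ab-p1 g8 (LAND-ASK of idea-22 g7). §0 of the source (a verbatim copy of `Literature/Analysis/OperatorTheory/HermitianKernelSandwichedTrace.lean`) is NOT landed (condition L2): the part that needs it imports the Literature module by name.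

HONEST FRAMING.  Abstract operator theory on `L²(X, μ; ℂ)` (Koopman unitaries, joint eigenbasis, trace formulas, kernel calculus); nothing located on the lattice is proved by this file (stubs S1, S3ʷ, T, N, S5ᵛ of row 47 open; D is re-located onto the lattice stub L `SliceRealisationV` in the last part); row 47 class PWP, mechanism 0, width 0; `IRcof` ∕ `IR` 0∕1; the Yang–Mills mass gap (Clay) is NOT proved by anything in this tree; R4 closes only the conditional finite-𝕋⁴ rung `BalabanLadder.UV`.
-/

noncomputable section

open MeasureTheory Filter Function Topology
open scoped InnerProductSpace ComplexConjugate ENNReal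
open Literature.Analysis.OperatorTheory

namespace Summit.QuantumFields.YangMills.Cruxes.IRcof.EquipartitionSeam.SpectralDict

variable {X : Type*} [MeasurableSpace X] {μ : Measure X}

/-! ## §8  The located lattice stub `SliceRealisationV` and the kernel-checked derivation of D (`SpectralDictV`) -/

section Lattice

open Literature.MathematicalPhysics.QuantumFieldTheory Literature.MathematicalPhysics.QuantumLattice
open Summit.QuantumFields.YangMills.Theorems.NonSimplyConnectedLatticeGap
open Summit.QuantumFields.YangMills.Cruxes.IRcof.EquipartitionSeam.KernelCurrency

/-- **L `SliceRealisationV` — TIME-SLICE REALISATION of the split-weight sector functions** (the located, purely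
lattice-side stub that REPLACES D for provers: REAL kernels, Haar/Fubini identities, no spectral theory).
For every admissible split weight `w` (beyond thresholds `β_D`, `S_D β` chosen with species thickness `thick ≥ 1` and size
`nrm ≥ 0`) and every sector base `z₀` on the box `(2S+1)⁴` there is a probability space `(X, μ)` (intended: the spatial
links of ONE time slice, `((Fin (2S+1))³ × Fin 3 → H)` with product Haar; `CountablyGenerated` from the faithful `ρH`,
cf. `BalabanBlockAverage` l.720), a bounded strongly measurable SYMMETRIC real kernel `K` of POSITIVE TYPE (intended: the
gauge-averaged slice-to-slice transfer kernel of the `w`-theory with the MAGNETIC part of `z₀` in the spatial plaquette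
weights — `K(V,V') = ∫ ∏_links w(V_l⁻¹ g_p V'_l g_{p+î}⁻¹) dg · (spatial weights)`, positive because `w` is a positive-type
class function (`TwistSplitWeight` clause 5) and gauge averaging is a projection commuting with the ungauged kernel;
Osterwalder–Seiler 1978, Seiler LNP 159 Ch. 2), a measure-preserving ACTION `T` of the electric twist group
`(Fin 3 → ker π)` leaving `K` invariant (intended: multiplication of the direction-`i` links on the stack `{x_i = 0}` by the
central element `e_i`), such that
(Z) `Z_w(z₀|e; (M+2) × (2S+1)³) = ∫ (κ^{M+1} K(·, x))(T_e x) dμ(x)` — the electric twist is the seam operator `U_e` in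
`tr U_e 𝔸^{M+2}` (move the Dirac sheet to one seam; `κ f = ∫ K(·,y) f(y) dμ(y)`), and
(W) for every species `A` with `4·thick A ≤ 2S+1`: a real block kernel `B_k` spanning `thick A = r_B + 1` steps, dominated
POINTWISE by `nrm A · P_{r_B}` (`pathK`, the `(r_B+1)`-step path kernel of `K`; `|A.F| ≤ nrm A` and `w ≥ 0`), independent
of `e` (species are functions of `π ∘ U`, blind to central multiplication, so the sheet can be moved off the block), with
`W_{w,A}(z₀|e) = ∫ k_e(V 0, V 1) ∏_{t<M+2} K(V (t+1), V (t+2)) dμ^{⊗(M+3)}`, `k_e(x,y) = ∫ K(x,u) ∫ B_k(u,v) K(T_e v, y)`,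
whenever `M + 4 + thick A = 2S+1` (cyclicity of the torus trace).
Why it might fail AS TYPED: only by a convention slip (orientation of `T_e` vs `withEl`, `Fin.succ` bond indexing, the
`finTorusConfigEquivSite` reindexing in `secW`) — each repairable by re-indexing inside the proof; the mathematics is the
classical transfer-matrix slicing [Osterwalder–Seiler 1978; Seiler 1982 LNP 159; Simon, Lattice Gases I §II.4].
Templates in the tree: `WilsonFinTorusSliceKernel`, `WilsonFinTorusSliceChain`, `WilsonFinTorusMagneticSliceKernel`,
`WilsonFinTorusSliceObservables`, `TwistedKernelTraceFormula.integral_cyclic_twisted_eq_integral_iterate`,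
`HeterogeneousCyclicPeeling` (block contraction), `PathKernelDomination`. -/
def SliceRealisationV : Prop :=
  ∀ (G : Type) [Group G] [TopologicalSpace G] [IsTopologicalGroup G] [CompactSpace G] [MeasurableSpace G]
    [BorelSpace G], IsCompactSimpleLieGroup G → ∀ (H : Type) [Group H] [TopologicalSpace H] [IsTopologicalGroup H]
    [CompactSpace H] [MeasurableSpace H] [BorelSpace H], IsCompactSimpleLieGroup H → SimplyConnectedSpace H →
    ∀ (π : H →* G), Continuous π → Function.Surjective π → π.ker ≤ Subgroup.center H → (π.ker : Set H).Finite →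
    π.ker ≠ ⊥ → ∀ (ρH : LatticeRep H) (r : LatticeRep G) (c : ℝ → ℝ), Tendsto (fun β => c β * β) atTop atTop →
      ∃ (thick : YMSpecies G → ℕ) (nrm : YMSpecies G → ℝ) (β_D : ℝ) (S_D : ℝ → ℕ),
        (∀ A : YMSpecies G, 1 ≤ thick A ∧ 0 ≤ nrm A) ∧
        ∀ β : ℝ, β_D ≤ β → ∀ w : H → ℝ, TwistSplitWeight π ρH r (c β) β w → ∀ S : ℕ, S_D β ≤ S →
          ∀ z₀ : Sector π,
            ∃ (X : Type) (_ : MeasurableSpace X) (μ : Measure X) (K : X → X → ℝ) (C : ℝ)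
              (T : (Fin 3 → ↥π.ker) → X → X),
              IsProbabilityMeasure μ ∧ MeasurableSpace.CountablyGenerated X ∧
              StronglyMeasurable (uncurry K) ∧ (∀ x y, ‖K x y‖ ≤ C) ∧ (∀ x y, K x y = K y x) ∧
              (∀ f : X → ℂ, Measurable f → (∀ x, ‖f x‖ ≤ 1) →
                0 ≤ (∫ x, ∫ y, conj (f x) * ((K x y : ℝ) : ℂ) * f y ∂μ ∂μ).re) ∧
              (∀ e, MeasurePreserving (T e) μ μ) ∧ T 1 = id ∧ (∀ a b, T (a * b) = T a ∘ T b) ∧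
              (∀ e x y, K (T e x) (T e y) = K x y) ∧
              (∀ (e : Fin 3 → ↥π.ker) (M : ℕ),
                secZ π w (withEl π z₀ e) S (M + 2) =
                  ∫ x, ((fun f : X → ℝ => fun u => ∫ y, K u y * f y ∂μ)^[M + 1] (fun y => K y x)) (T e x) ∂μ) ∧
              (∀ A : YMSpecies G, 4 * thick A ≤ 2 * S + 1 →
                ∃ (rB : ℕ) (Bk : X → X → ℝ) (CB : ℝ), rB + 1 = thick A ∧ StronglyMeasurable (uncurry Bk) ∧
                  (∀ x y, ‖Bk x y‖ ≤ CB) ∧ (∀ x y, |Bk x y| ≤ nrm A * pathK μ K rB x y) ∧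
                  ∀ (e : Fin 3 → ↥π.ker) (M : ℕ), M + 4 + thick A = 2 * S + 1 →
                    secW π w (withEl π z₀ e) S A =
                      ∫ V : Fin (M + 3) → X, (∫ u, K (V 0) u * ∫ v, Bk u v * K (T e v) (V 1) ∂μ ∂μ) *
                        ∏ t : Fin (M + 2), K (V t.succ) (V (t.succ + 1)) ∂(Measure.pi fun _ => μ))

/-- **D from L: the spectral dictionary `SpectralDictV` (stub D of skeleton rev 8, VERBATIM text of `KernelDefs`) follows from
the slice realisation** — joint eigenbasis of the complexified transfer operator and the commuting unitary twists (§3),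
twisted trace formula (§4/§7), growth rate `= ‖𝔸‖` (§5), block coefficients bounded by path-kernel domination (§6) and the
sandwiched trace formula (§0/§7).  Sorry-free. -/
theorem spectralDictV_of_sliceRealisationV (hL : SliceRealisationV) : SpectralDictV := by
  intro G _ _ _ _ _ _ hG H _ _ _ _ _ _ hH hsc π hπc hπs hker hfin hne ρH r c hc
  obtain ⟨thick, nrm, β_D, S_D, hthick, hmain⟩ := hL G hG H hH hsc π hπc hπs hker hfin hne ρH r c hc
  refine ⟨thick, nrm, β_D, S_D, fun β hβ w hw S hS z₀ => ?_⟩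
  obtain ⟨X, mX, μ, K, C, T, hprob, hcg, hK, hC, hsymm, hpt, hTm, hT1, hTmul, hKT, hZ, hW⟩ :=
    hmain β hβ w hw S hS z₀
  classical
  -- a nonnegative bound
  have hC' : ∀ x y, ‖K x y‖ ≤ max C 0 := fun x y => (hC x y).trans (le_max_left _ _)
  -- the complexified kernel and its operator `𝔸`
  set Kc : X → X → ℂ := fun x y => ((K x y : ℝ) : ℂ) with hKcdef
  have hKc : StronglyMeasurable (uncurry Kc) := Complex.continuous_ofReal.comp_stronglyMeasurable hK
  have hCc : ∀ x y, ‖Kc x y‖ ≤ max C 0 := fun x y => by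
    simp only [hKcdef, Complex.norm_real]; exact hC' x y
  have hherm : ∀ x y, Kc x y = conj (Kc y x) := fun x y => by simp only [hKcdef, Complex.conj_ofReal, hsymm]
  obtain ⟨A, hA⟩ := exists_kernelOp_rclike (𝕜 := ℂ) (μ := μ) hKc hCc
  have hAsa : IsSelfAdjoint A := isSelfAdjoint_of_ae_hermitianKernel hKc hCc hherm hA
  have hAc : IsCompactOperator A := isCompactOperator_of_ae_kernel hCc (le_max_right _ _) hA
  have hpos : ∀ φ : Lp ℂ 2 μ, 0 ≤ (⟪φ, A φ⟫_ℂ).re := re_inner_kernelOp_self_nonneg hA hpt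
  have hAU : ∀ e, A * koop (T e) (hTm e) = koop (T e) (hTm e) * A :=
    kernelOp_mul_koop hTm hKc hA (fun e x y => by simp only [hKcdef, hKT])
  have hcomm : ∀ a b : Fin 3 → ↥π.ker, a * b = b * a := fun a b => funext fun i => Subtype.ext (by
    simp only [Pi.mul_apply, Subgroup.coe_mul]
    exact (Subgroup.mem_center_iff.mp (hker (a i).2) (b i)).symm)
  obtain ⟨s, b, lam, χ, hcoe, hb, hlam, hχmul, hχnorm, hχ, -⟩ :=
    exists_jointEigenbasis hTm hT1 hTmul hcomm hAsa hAc hAU hpos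
  -- countability of the basis (separability of `L²` of a countably generated probability space)
  haveI : Fact ((2 : ℝ≥0∞) ≠ ∞) := ⟨ENNReal.ofNat_ne_top⟩
  haveI : MeasurableSpace.CountablyGenerated X := hcg
  have hsc' : s.Countable := by
    have hon : Orthonormal ℂ ((↑) : s → Lp ℂ 2 μ) := by
      have h : ((↑) : s → Lp ℂ 2 μ) = ⇑b := funext fun i => (hcoe i).symm
      rw [h]; exact b.orthonormal
    exact hon.countable_of_separableSpace
  haveI : Countable s := hsc'.to_subtype
  -- (Z) in cast form, for every twist and every time extent ≥ 2
  have hZc : ∀ (e : Fin 3 → ↥π.ker) (M : ℕ),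
      HasSum (fun i : s => χ i e * (lam i : ℂ) ^ (M + 2)) ((secZ π w (withEl π z₀ e) S (M + 2) : ℝ) : ℂ) := by
    intro e M
    rw [hZ e M]
    exact hasSum_chi_pow_ofReal_iterate hTm hK hC hsymm hA hb hχ e M
  -- the trivial twist has trivial characters
  have hχ1 : ∀ i : s, χ i 1 = 1 := fun i => by
    have hne : χ i 1 ≠ 0 := fun h0 => by
      have h := hχnorm i 1; rw [h0, norm_zero] at h; exact zero_ne_one h
    have h1 : χ i 1 * χ i 1 = χ i 1 * 1 := by rw [mul_one, ← hχmul, mul_one]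
    exact mul_left_cancel₀ hne h1
  -- growth rate `= ‖𝔸‖`
  have hgrowth : growthRate π w z₀ S = ‖A‖ := by
    refine limsup_rpow_eq_norm b hAsa hAc (fun φ => by simpa using hpos φ) hb (fun i => (hlam i).1)
      (Z := fun m => secZ π w (elOff π z₀) S (m + 1)) fun n => ?_
    have h := hZc 1 n
    simp_rw [hχ1, one_mul] at h
    have h' : HasSum (fun i : s => ((lam i ^ (n + 2) : ℝ) : ℂ)) ((secZ π w (withEl π z₀ 1) S (n + 2) : ℝ) : ℂ) := by
      simpa only [Complex.ofReal_pow] using h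
    exact Complex.hasSum_ofReal.mp h'
  -- the package
  refine ⟨s, lam, χ, fun i => ⟨(hlam i).1, hgrowth ▸ (hlam i).2⟩, hχmul, hχnorm, fun m hm e => ?_, fun A' hA' => ?_⟩
  · obtain ⟨M, rfl⟩ : ∃ M, m = M + 2 := ⟨m - 2, by omega⟩
    simpa only [Complex.ofReal_pow] using hZc e M
  · obtain ⟨rB, Bk, CB, hrB, hBk, hCB, hdom, hWid⟩ := hW A' hA'
    set Bc : X → X → ℂ := fun x y => ((Bk x y : ℝ) : ℂ) with hBcdef
    have hBc : StronglyMeasurable (uncurry Bc) := Complex.continuous_ofReal.comp_stronglyMeasurable hBk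
    have hCBc : ∀ x y, ‖Bc x y‖ ≤ CB := fun x y => by simp only [hBcdef, Complex.norm_real]; exact hCB x y
    obtain ⟨B, hB⟩ := exists_kernelOp_rclike (𝕜 := ℂ) (μ := μ) hBc hCBc
    refine ⟨fun i => ⟪(b i : Lp ℂ 2 μ), B (b i)⟫_ℂ, (hthick A').2, fun i => ?_, fun e => ?_⟩
    · have h := norm_inner_le_of_abs_le_pathK hK hC hA hBk hCB hB (hthick A').2 hdom (b i)
      rw [b.orthonormal.1 i, one_pow, mul_one, hrB, ← hgrowth] at h
      exact h
    · obtain ⟨M, hM⟩ : ∃ M, M + 4 + thick A' = 2 * S + 1 := ⟨2 * S + 1 - thick A' - 4, by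
        have h1 := (hthick A').1; omega⟩
      have h := hasSum_chi_pow_inner_block hTm hK hC hsymm hA hb hχ hBk hCB hB e M
      rw [← hWid e M hM] at h
      have hexp : 2 * S + 1 - thick A' = M + 4 := by omega
      rw [hexp]
      exact h

end Lattice

end Summit.QuantumFields.YangMills.Cruxes.IRcof.EquipartitionSeam.SpectralDict

end
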